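import Summits.ValiantsHypothesis.ValiantsHypothesis.Cruxes.DualUnipotentThreeHalves.Lines.radical_split

/-!
# Slow by cancellation — the DEGREE-currency repair `R2°` of R2 `HeavyTopLaw` (val-idea-28 g5, crux 24318)

Status: VP≠VNP NOT proved; crux 24318 `DualUnipotentThreeHalves` OPEN.  Nothing here is asserted as a law:
`HeavyTopSlowLaw` (R2°) is a HYPOTHESIS of the composition theorems, exactly as `HeavyTopLaw` (R2) is in
`Lines/radical_split.lean`.

rev 2 — CREDIT AND NAMES OF RECORD.  The observation «S3 survives E(n): E(n) is SLOW with the trivial certificate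
`K = N_lin⁻¹(U ⊕ 0)`, `k = 0`; restub R2 in POWER currency as `HeavyTopSlowLaw`» is val-idea-31 g4's (val-width
2026-08-28T22:09:46Z, CLAIM-FIRST; second leg val-htc-lead g0 22:13:31Z; this file/memo = the third, independent,
machine-checked leg, booked R309 (3)).  §1 below is a PARALLEL TYPING whose statements are IDENTICAL (up to the names
`SlowCheap` ↔ `Slow`, `slowPlane_of_split'` ↔ `slowPlane_of_split`, `dualUnipotentThreeHalves_of_slowLaw` ↔
`dualUnipotentThreeHalves_of`) to the successor DRAFT OF RECORD `Lines/slow_core.lean` (val-port-2 g3 @970df9a6f625,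
22:19:50Z; R309) and to `PowerSieve.lean` §1 (val-idea-31 g4) — USE THOSE NAMES; the general absorption / tower lemmas
(block-triangular, any affine glue) are PowerSieve §2b–§2c (`totalDegree_pow_shortGlue_le`, `slow_of_triu`, 0 sorries),
of which `blockSum_linePencil_pow` below is only the direct-sum, budget-0 case.  What is specific to this file:
`linePencil_pow_eq_zero` (a POINTWISE identity `u ^ p = 0` on a linear space over `ℂ` extends to the line pencil over
`ℂ[s]`, via `MvPolynomial.funext`) and the memo `MEMO-g5-slow-by-cancellation.md` (second-derivation leg of idea-30's
¬R2 claim; pattern-pencil and coupled-extension remarks for RED).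

WHY THIS FILE.  The ratio–knapsack pencils `E(n) = U_{h,k} ⊕ Band` (val-idea-30 g3, `MEMO-idea30-g3-ratio-knapsack.md`
rev 2; critic annex `CRITIC-V19-UniformWeightLaw-dead.md`) kill, on paper, the FLAG-currency certificate laws
(`UniformWeightLaw`, and — second leg pending — R2 `HeavyTopLaw` ⟺ `HeavyTopWordLaw`, hence S3b `FlagCostLaw`).
But line #1 never needed flag-cheapness: it consumes S3 `SlowPlane` (DEGREE currency) through
`dualUnipotentThreeHalves_of_slowPlane`, and flag-cheapness enters only as the sufficient certificate S3a `RunBound`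
(✓ `runBound_proof`).  E(n) is SLOW BY CANCELLATION: with `K := N_lin⁻¹(U ⊕ 0)` (dimension `k² + 1 > n`) every
line `x + s v`, `v ∈ K`, has `(N(x + s v))^{n-1} = (u₀ + s u₁)^{n-1} ⊕ z₀^{n-1}` with `u₀, u₁ ∈ U`; since `X^h = 0`
is a POLYNOMIAL IDENTITY on `U` it holds over `ℂ[s]` (`linePencil_pow_eq_zero` below), so the `U`-block vanishes
(`n - 1 ≥ h`) and the band block is constant: all entries have `s`-degree `0`, i.e. the conclusion of S3 holds for
E(n) at budget `k = 0` — although the individual words in `u₀, u₁` do NOT vanish (the rigid words of the kill), only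
their fixed-letter-count sums do.  This is the `FlagCostLaw` docstring's foreseen failure mode (b) «a pencil slow only by
cancellation».

CONTENTS (all sorry-free):
* `SlowCheap n m N` — the conclusion of S3 at format `(n, m)` ("degree-cheap"); `slowCheap_of_flagCheap` = S3a by name.
* `HeavyTopSlowLaw` (R2°) — R2's hypotheses, S3's conclusion; `heavyTopSlowLaw_of_heavyTopLaw : HeavyTopLaw → HeavyTopSlowLaw`
  (R2° is WEAKER than R2), `slowPlane_of_split' : RadicalCoarsening → HeavyTopSlowLaw → SlowPlane` (the Wedderburn split of
  line #1 re-glued one level down), `dualUnipotentThreeHalves_of_slowLaw : HeavyTopSlowLaw → DualUnipotentThreeHalves`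
  (S1 ✓, S2 ✓ GMS fact discharged, R1 ✓ `radicalCoarsening`, S3a ✓ — so after this file the crux follows from R2° ALONE).
* `linePencil_pow_eq_zero` — SLOW BY CANCELLATION: `(∀ u ∈ U, u ^ p = 0) → P Q ∈ U → (P + s·Q)^p = 0` over `ℂ[s]`
  (polynomial-identity extension via `MvPolynomial.funext`).
* `add_pow_eq_of_mul_eq_zero`, `blockSum_linePencil_pow` — the `U ⊕ Z` mechanism at matrix level: for mutually annihilating
  blocks, `((u₀ + z₀) + s·u₁)^L = z₀^L` (constant in `s`) once `L ≥ p`, `L ≥ 1`.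

What R2° does NOT dissolve (honest residual): COUPLED extensions (graph-like subspaces of `End V₁ ⊕ End V₂`) and block sums
all of whose fat corners have nil-index `≈ n`; and the irreducible locus (`pencilAlg N = ⊤`), where `IndexCoreLaw` ⇒
`FlagCheap` ⇒ `SlowCheap` is the route of record.  [this crux dir: MEMO-g5-slow-by-cancellation.md; Lines/radical_split.lean;
MEMO-idea30-g3-ratio-knapsack.md; CRITIC-V19-UniformWeightLaw-dead.md]
-/

set_option linter.dupNamespace false

noncomputable section

namespace Summit.ValiantsHypothesis.ValiantsHypothesis.Cruxes.DualUnipotentThreeHalves.SlowByCancellation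

open MvPolynomial Matrix
open scoped BigOperators
open Summit.ValiantsHypothesis.ValiantsHypothesis.Cruxes.TwoDimCoefficients.DimTwoCases (AffMat IsAffine)
open Summit.ValiantsHypothesis.ValiantsHypothesis.Cruxes.DualUnipotentThreeHalves.RadicalSplit
open Summit.ValiantsHypothesis.ValiantsHypothesis.Theses.GrenetZeon (DualUnipotentThreeHalves)

/-! ## §1 Degree currency: `SlowCheap`, R2° and the re-glued line -/

/-- **DEGREE-CHEAP** — the conclusion of S3 `SlowPlane` at format `(n, m)`: a direction space `K` with `(k+1)·n < dim K`
along whose lines the `(n-1)`-th power of the substituted pencil has all entries of `s`-degree `≤ k`. -/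
def SlowCheap (n m : ℕ) (N : AffMat n m) : Prop :=
  ∃ (K : Submodule ℂ (Fin n × Fin n → ℂ)) (k : ℕ),
    (∀ x v : Fin n × Fin n → ℂ, v ∈ K → ∀ i j : Fin m,
      (((N.map (lineSubst x v)) ^ (n - 1)) i j).totalDegree ≤ k) ∧
    (k + 1) * n < Module.finrank ℂ K

/-- **R2° — HEAVY-TOP SLOW LAW** (the degree-currency restatement of R2; a HYPOTHESIS here, never asserted): below
`C₀·m² < n³`, an affine nilpotent pencil all of whose trace-orthogonal direction spaces are small is DEGREE-cheap.
R2 ⇒ R2° (`heavyTopSlowLaw_of_heavyTopLaw`); the knapsack pencils E(n) satisfy R2°'s conclusion at budget `0`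
(slow by cancellation), so the paper refutation of R2 does not touch R2°.  Why it might fail: an IRREDUCIBLE heavy-top
nilpotent pencil (pencil algebra `= ⊤`) with no slow plane — the `IndexCoreLaw` locus — or a coupled extension of two
long corners. [this file; Lines/radical_split.lean; MEMO-idea30-g3-ratio-knapsack.md] -/
def HeavyTopSlowLaw : Prop :=
  ∃ C₀ n₀ : ℕ, ∀ n ≥ n₀, ∀ m : ℕ, C₀ * m ^ 2 < n ^ 3 → ∀ N : AffMat n m, IsAffine N → N ^ m = 0 →
    (∀ K : Submodule ℂ (Fin n × Fin n → ℂ), RadOrth n m N K →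
      Module.finrank ℂ K ≤ 16 * m * Nat.sqrt n + 16 * n) →
    SlowCheap n m N

/-- S3a by name: flag-cheap ⇒ degree-cheap (✓ `runBound_proof`). -/
theorem slowCheap_of_flagCheap {n m : ℕ} (N : AffMat n m) (h : FlagCheap n m N) : SlowCheap n m N :=
  runBound_proof n m N h

/-- **R2 ⇒ R2°**: the degree law is weaker than the flag law. -/
theorem heavyTopSlowLaw_of_heavyTopLaw (h : HeavyTopLaw) : HeavyTopSlowLaw := by
  obtain ⟨C₀, n₀, h⟩ := h
  exact ⟨C₀, n₀, fun n hn m hm N hN hnil htop => slowCheap_of_flagCheap N (h n hn m hm N hN hnil htop)⟩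

/-- `SlowPlane` is literally «regime ⇒ `SlowCheap`». -/
theorem slowPlane_iff :
    SlowPlane ↔ ∃ C₀ n₀ : ℕ, ∀ n ≥ n₀, ∀ m : ℕ, C₀ * m ^ 2 < n ^ 3 → ∀ N : AffMat n m, IsAffine N → N ^ m = 0 →
      SlowCheap n m N :=
  Iff.rfl

/-- **R1 + R2° ⇒ S3** — the Wedderburn split of line #1 (`flagCostLaw_of_split`) re-glued in degree currency: on the
light-top branch R1 gives a flag and S3a turns it into a slow plane; on the heavy-top branch R2° gives the slow plane. -/
theorem slowPlane_of_split' (hR1 : RadicalCoarsening) (hR2 : HeavyTopSlowLaw) : SlowPlane := by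
  obtain ⟨C₀, n₀, h⟩ := hR2
  refine ⟨C₀, n₀, fun n hn m hm N hN hnil => ?_⟩
  by_cases hK : ∃ K : Submodule ℂ (Fin n × Fin n → ℂ),
      RadOrth n m N K ∧ 16 * m * Nat.sqrt n + 16 * n < Module.finrank ℂ K
  · obtain ⟨K, hK1, hK2⟩ := hK
    exact slowCheap_of_flagCheap N (hR1 n m N hN K hK1 hK2)
  · push Not at hK
    exact h n hn m hm N hN hnil hK

/-- **The line through R2° (sorry-free up to the hypothesis):** S1 ✓ `stub_permRank_of_lineFlat`, S2 ✓ `stub_gms`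
(GMS fact discharged), R1 ✓ `stub_radicalCoarsening`, S3a ✓ inside `slowPlane_of_split'`. -/
theorem dualUnipotentThreeHalves_of_slowLaw (hR2 : HeavyTopSlowLaw) : DualUnipotentThreeHalves :=
  dualUnipotentThreeHalves_of_slowPlane stub_permRank_of_lineFlat stub_gms
    (slowPlane_of_split' stub_radicalCoarsening hR2)

/-! ## §2 Slow by cancellation -/

variable {m : ℕ}

/-- **SLOW BY CANCELLATION** (polynomial-identity extension).  If every element of a linear space `U` of matrices
satisfies `u ^ p = 0`, then for `P, Q ∈ U` the one-variable pencil `P + s·Q` satisfies `(P + s·Q) ^ p = 0` over `ℂ[s]`: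
each coefficient `Σ_{words with j letters Q} word = 0`, although single words need not vanish. [folklore; this file] -/
theorem linePencil_pow_eq_zero (U : Submodule ℂ (Matrix (Fin m) (Fin m) ℂ)) {p : ℕ} (hU : ∀ u ∈ U, u ^ p = 0)
    {P Q : Matrix (Fin m) (Fin m) ℂ} (hP : P ∈ U) (hQ : Q ∈ U) :
    (P.map (C : ℂ → MvPolynomial (Fin 1) ℂ) + (X 0 : MvPolynomial (Fin 1) ℂ) • Q.map (C : ℂ → MvPolynomial (Fin 1) ℂ)) ^ p
      = 0 := by
  set M : Matrix (Fin m) (Fin m) (MvPolynomial (Fin 1) ℂ) :=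
    P.map (C : ℂ → MvPolynomial (Fin 1) ℂ) + (X 0 : MvPolynomial (Fin 1) ℂ) • Q.map (C : ℂ → MvPolynomial (Fin 1) ℂ)
    with hM
  refine Matrix.ext fun i j => ?_
  apply MvPolynomial.funext
  intro x
  have hMx : M.map (MvPolynomial.eval x) = P + (x 0) • Q := by
    ext a b
    simp [hM, Matrix.map_apply, Matrix.add_apply, Matrix.smul_apply, smul_eq_mul]
  have hx : (M ^ p).map (MvPolynomial.eval x) = (P + (x 0) • Q) ^ p := by
    rw [Matrix.map_pow M (MvPolynomial.eval x) p, hMx]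
  have hmem : P + (x 0) • Q ∈ U := U.add_mem hP (U.smul_mem _ hQ)
  have h0 : (P + (x 0) • Q) ^ p = 0 := hU _ hmem
  have hij := congr_fun (congr_fun hx i) j
  rw [Matrix.map_apply, h0] at hij
  rw [hij]
  simp

/-- Mutually annihilating summands: `(a + b)^L = a^L + b^L` for `L ≥ 1`. -/
theorem add_pow_eq_of_mul_eq_zero {R : Type*} [Ring R] (a b : R) (hab : a * b = 0) (hba : b * a = 0) :
    ∀ L : ℕ, 1 ≤ L → (a + b) ^ L = a ^ L + b ^ L
  | 0, h => absurd h (by decide)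
  | 1, _ => by simp
  | (L + 2), _ => by
      have ih := add_pow_eq_of_mul_eq_zero a b hab hba (L + 1) (by omega)
      have haLb : a ^ (L + 1) * b = 0 := by rw [pow_succ, mul_assoc, hab, mul_zero]
      have hbLa : b ^ (L + 1) * a = 0 := by rw [pow_succ, mul_assoc, hba, mul_zero]
      rw [pow_succ, ih, add_mul, mul_add, mul_add, haLb, hbLa, add_zero, zero_add, ← pow_succ, ← pow_succ]

/-- **The `U ⊕ Z` mechanism at matrix level** (E(n)-type block sums are slow).  If `U` and `Z` annihilate each other
(`u z = z u = 0`), every `u ∈ U` has `u ^ p = 0`, and `L ≥ p`, `L ≥ 1`, then for `u₀, u₁ ∈ U`, `z₀ ∈ Z` the line pencil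
`(u₀ + z₀) + s·u₁` has `L`-th power `z₀ ^ L` — CONSTANT in `s` (all entries of `s`-degree `0`). -/
theorem blockSum_linePencil_pow (U Z : Submodule ℂ (Matrix (Fin m) (Fin m) ℂ))
    (hUZ : ∀ u ∈ U, ∀ z ∈ Z, u * z = 0) (hZU : ∀ u ∈ U, ∀ z ∈ Z, z * u = 0)
    {p : ℕ} (hU : ∀ u ∈ U, u ^ p = 0) {L : ℕ} (hpL : p ≤ L) (hL : 1 ≤ L)
    {u₀ u₁ z₀ : Matrix (Fin m) (Fin m) ℂ} (hu₀ : u₀ ∈ U) (hu₁ : u₁ ∈ U) (hz₀ : z₀ ∈ Z) :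
    ((u₀ + z₀).map (C : ℂ → MvPolynomial (Fin 1) ℂ)
        + (X 0 : MvPolynomial (Fin 1) ℂ) • u₁.map (C : ℂ → MvPolynomial (Fin 1) ℂ)) ^ L
      = (z₀ ^ L).map (C : ℂ → MvPolynomial (Fin 1) ℂ) := by
  -- abbreviations
  set a : Matrix (Fin m) (Fin m) (MvPolynomial (Fin 1) ℂ) :=
    u₀.map (C : ℂ → MvPolynomial (Fin 1) ℂ) + (X 0 : MvPolynomial (Fin 1) ℂ) • u₁.map (C : ℂ → MvPolynomial (Fin 1) ℂ)
    with ha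
  set b : Matrix (Fin m) (Fin m) (MvPolynomial (Fin 1) ℂ) := z₀.map (C : ℂ → MvPolynomial (Fin 1) ℂ) with hb
  have hsplit : (u₀ + z₀).map (C : ℂ → MvPolynomial (Fin 1) ℂ)
      + (X 0 : MvPolynomial (Fin 1) ℂ) • u₁.map (C : ℂ → MvPolynomial (Fin 1) ℂ) = a + b := by
    rw [ha, hb, Matrix.map_add (C : ℂ → MvPolynomial (Fin 1) ℂ) (map_add (C : ℂ →+* MvPolynomial (Fin 1) ℂ)) u₀ z₀]
    abel
  -- products across the blocks vanish (map `C` is a ring hom on matrices)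
  have hmapmul : ∀ x y : Matrix (Fin m) (Fin m) ℂ,
      x.map (C : ℂ → MvPolynomial (Fin 1) ℂ) * y.map (C : ℂ → MvPolynomial (Fin 1) ℂ)
        = (x * y).map (C : ℂ → MvPolynomial (Fin 1) ℂ) := fun x y => (Matrix.map_mul (f := (C : ℂ →+* MvPolynomial (Fin 1) ℂ))).symm
  have hab : a * b = 0 := by
    rw [ha, hb, add_mul, Matrix.smul_mul, hmapmul, hmapmul, hUZ u₀ hu₀ z₀ hz₀, hUZ u₁ hu₁ z₀ hz₀]
    simp
  have hba : b * a = 0 := by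
    rw [ha, hb, mul_add, Matrix.mul_smul, hmapmul, hmapmul, hZU u₀ hu₀ z₀ hz₀, hZU u₁ hu₁ z₀ hz₀]
    simp
  have haL : a ^ L = 0 := by
    have hp : a ^ p = 0 := by rw [ha]; exact linePencil_pow_eq_zero U hU hu₀ hu₁
    obtain ⟨d, rfl⟩ := Nat.exists_eq_add_of_le hpL
    rw [pow_add, hp, zero_mul]
  rw [hsplit, add_pow_eq_of_mul_eq_zero a b hab hba L hL, haL, zero_add, hb,
    Matrix.map_pow z₀ (C : ℂ →+* MvPolynomial (Fin 1) ℂ) L]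

end Summit.ValiantsHypothesis.ValiantsHypothesis.Cruxes.DualUnipotentThreeHalves.SlowByCancellation

end
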